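import Mathlib.Analysis.SpecialFunctions.Trigonometric.Bounds
import Mathlib.Analysis.SpecialFunctions.Trigonometric.Deriv
import Mathlib.Analysis.Calculus.Deriv.MeanValue
import HarnessLib

/-!
# RH-FREE toolbox for the corner gap (L2 of `ScrewManifestCornerGap`): size and equicontinuity of cosine-atom sums

The corner-gap slot `Manifest.CornerGap` concerns nonnegative atom sums
`Φ(s) = Σ_k W_k·(1 − cos(τ_k s))/τ_k²` (the rescaled wave atoms of a manifest certificate).  Step (ii) of
sos-theory's proof route (note SCREW-P3-FOLD-NOTE-g19 §2, L2: mass control, EQUICONTINUITY, Helly, evenness)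
is the uniform Lipschitz bound `|Φ′| ≤ B·ΣW` on `[−B, B]`; this file records it, with the pointwise sizes:

* `cosAtom_nonneg`, `cosAtom_le_sq_half` : `0 ≤ (1 − cos(τ s))/τ² ≤ s²/2`;
* `hasDerivAt_cosAtom` : `d/ds (1 − cos(τ s))/τ² = sin(τ s)/τ` (`τ ≠ 0`), `abs_sin_mul_div_le` : `|sin(τ s)/τ| ≤ |s|`;
* `abs_cosAtomSum_sub_le` : for `W ≥ 0`, `τ_k ≠ 0`, `|s|, |s'| ≤ B`:
  `|Φ(s) − Φ(s')| ≤ B·(Σ_k W_k)·|s − s'|`;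
* `cosAtomSum_nonneg`, `cosAtomSum_le` : `0 ≤ Φ(s) ≤ (s²/2)·Σ_k W_k`.

RH-FREE elementary calculus; nothing here bears on the truth of RH.  References: [folklore].
-/

set_option linter.dupNamespace false
set_option autoImplicit false

noncomputable section

open Real Set Finset

namespace Summit.RiemannHypothesis.RiemannHypothesis.Theorems.IntegerScrew.Manifest

/-- `0 ≤ (1 − cos(τ s))/τ²`. [folklore] -/
theorem cosAtom_nonneg (τ s : ℝ) : 0 ≤ (1 - Real.cos (τ * s)) / τ ^ 2 :=
  div_nonneg (by linarith [Real.cos_le_one (τ * s)]) (sq_nonneg τ)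

/-- `(1 − cos(τ s))/τ² ≤ s²/2` (`1 − x²/2 ≤ cos x`). [folklore] -/
theorem cosAtom_le_sq_half (τ s : ℝ) : (1 - Real.cos (τ * s)) / τ ^ 2 ≤ s ^ 2 / 2 := by
  rcases eq_or_ne τ 0 with h | h
  · simp [h]; positivity
  · rw [div_le_iff₀ (by positivity)]
    have := Real.one_sub_sq_div_two_le_cos (x := τ * s)
    nlinarith [this]

/-- `d/ds (1 − cos(τ s))/τ² = sin(τ s)/τ` for `τ ≠ 0`. [folklore] -/
theorem hasDerivAt_cosAtom {τ : ℝ} (hτ : τ ≠ 0) (s : ℝ) :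
    HasDerivAt (fun s : ℝ => (1 - Real.cos (τ * s)) / τ ^ 2) (Real.sin (τ * s) / τ) s := by
  have h1 : HasDerivAt (fun s : ℝ => τ * s) τ s := by
    simpa using (hasDerivAt_id s).const_mul τ
  have h2 := ((hasDerivAt_const s (1 : ℝ)).sub h1.cos).div_const (τ ^ 2)
  refine h2.congr_deriv ?_
  field_simp
  ring

/-- `|sin(τ s)/τ| ≤ |s|` for `τ ≠ 0`. [folklore] -/
theorem abs_sin_mul_div_le {τ : ℝ} (hτ : τ ≠ 0) (s : ℝ) : |Real.sin (τ * s) / τ| ≤ |s| := by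
  rw [abs_div, div_le_iff₀ (abs_pos.mpr hτ)]
  have h := Real.abs_sin_le_abs (x := τ * s)
  rw [abs_mul] at h
  linarith [h]

/-- **Equicontinuity of nonnegative atom sums.** For `W ≥ 0`, `τ_k ≠ 0` and `|s|, |s'| ≤ B`:
`|Σ_k W_k(1 − cos(τ_k s))/τ_k² − Σ_k W_k(1 − cos(τ_k s'))/τ_k²| ≤ B·(Σ_k W_k)·|s − s'|`. [folklore] -/
theorem abs_cosAtomSum_sub_le {K : ℕ} (τ W : Fin K → ℝ) (hτ : ∀ k, τ k ≠ 0) (hW : ∀ k, 0 ≤ W k)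
    {B s s' : ℝ} (hs : |s| ≤ B) (hs' : |s'| ≤ B) :
    |(∑ k, W k * (1 - Real.cos (τ k * s)) / (τ k) ^ 2)
        - ∑ k, W k * (1 - Real.cos (τ k * s')) / (τ k) ^ 2| ≤ B * (∑ k, W k) * |s - s'| := by
  set Φ : ℝ → ℝ := fun x => ∑ k, W k * (1 - Real.cos (τ k * x)) / (τ k) ^ 2 with hΦ
  set Φ' : ℝ → ℝ := fun x => ∑ k, W k * (Real.sin (τ k * x) / τ k) with hΦ'
  have hB : 0 ≤ B := le_trans (abs_nonneg s) hs
  have hderiv : ∀ x ∈ Icc (-B) B, HasDerivWithinAt Φ (Φ' x) (Icc (-B) B) x := by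
    intro x _
    have h : HasDerivAt Φ (Φ' x) x := by
      have := HasDerivAt.fun_sum (u := (univ : Finset (Fin K)))
        (A := fun k x => W k * (1 - Real.cos (τ k * x)) / (τ k) ^ 2)
        (A' := fun k => W k * (Real.sin (τ k * x) / τ k)) (x := x)
        (fun k _ => by
          have h1 := (hasDerivAt_cosAtom (hτ k) x).const_mul (W k)
          have e : (fun s : ℝ => W k * ((1 - Real.cos (τ k * s)) / τ k ^ 2))
              = fun s => W k * (1 - Real.cos (τ k * s)) / τ k ^ 2 := by
            funext s; ring
          rw [e] at h1
          exact h1)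
      exact this
    exact h.hasDerivWithinAt
  have hbound : ∀ x ∈ Icc (-B) B, ‖Φ' x‖ ≤ B * ∑ k, W k := by
    intro x hx
    have hxB : |x| ≤ B := abs_le.mpr ⟨hx.1, hx.2⟩
    rw [Real.norm_eq_abs]
    calc |Φ' x| ≤ ∑ k, |W k * (Real.sin (τ k * x) / τ k)| := abs_sum_le_sum_abs _ _
      _ ≤ ∑ k, W k * B := by
          refine sum_le_sum fun k _ => ?_
          rw [abs_mul, abs_of_nonneg (hW k)]
          exact mul_le_mul_of_nonneg_left (le_trans (abs_sin_mul_div_le (hτ k) x) hxB) (hW k)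
      _ = B * ∑ k, W k := by rw [← sum_mul]; ring
  have hsI : s ∈ Icc (-B) B := ⟨(abs_le.mp hs).1, (abs_le.mp hs).2⟩
  have hs'I : s' ∈ Icc (-B) B := ⟨(abs_le.mp hs').1, (abs_le.mp hs').2⟩
  have h := Convex.norm_image_sub_le_of_norm_hasDerivWithin_le hderiv hbound (convex_Icc _ _) hs'I hsI
  rw [Real.norm_eq_abs, Real.norm_eq_abs] at h
  simpa [hΦ, mul_assoc] using h

/-- `0 ≤ Φ(s)` for `W ≥ 0`. [folklore] -/
theorem cosAtomSum_nonneg {K : ℕ} (τ W : Fin K → ℝ) (hW : ∀ k, 0 ≤ W k) (s : ℝ) :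
    0 ≤ ∑ k, W k * (1 - Real.cos (τ k * s)) / (τ k) ^ 2 :=
  sum_nonneg fun k _ => by
    rw [mul_div_assoc]; exact mul_nonneg (hW k) (cosAtom_nonneg _ _)

/-- `Φ(s) ≤ (s²/2)·Σ_k W_k` for `W ≥ 0`. [folklore] -/
theorem cosAtomSum_le {K : ℕ} (τ W : Fin K → ℝ) (hW : ∀ k, 0 ≤ W k) (s : ℝ) :
    (∑ k, W k * (1 - Real.cos (τ k * s)) / (τ k) ^ 2) ≤ s ^ 2 / 2 * ∑ k, W k := by
  rw [mul_sum]
  refine sum_le_sum fun k _ => ?_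
  rw [mul_div_assoc, mul_comm (s ^ 2 / 2)]
  exact mul_le_mul_of_nonneg_left (cosAtom_le_sq_half _ _) (hW k)

end Summit.RiemannHypothesis.RiemannHypothesis.Theorems.IntegerScrew.Manifest

end
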